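import Literature.NumberTheory.EllipticCurves.AnticyclotomicBigGaloisRep
import Literature.NumberTheory.EllipticCurves.ZpExtensionGaloisTwistPrimary
import Literature.NumberTheory.EllipticCurves.IwasawaAlgebra
import Mathlib.NumberTheory.Padics.RingHoms
import HarnessLib

/-!
# T-42-mult in the kernel, LII — P49-KERNEL (10): the `θ_u`-KERNEL of the co-induced module
# `𝒜 = C^∞(ℤ_p, A)`: `𝒜[θ_u] ≅ A` by evaluation at `0`, with `g ∈ G` acting through `u^{κ(g)} ρ(g)`

Cell `bsd-2adic` (run/shared/lean/pub/bsd-2adic/), seat `bsd-2adic-t42` GEN 19 (pen RC-337; memo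
`t42/DESIGN-T42-ADDENDUM-22` §A22.3 file (T)). HONEST FRAMING: research route; THEOREMS ONLY (no `def`, no named
fact, no instance, no `sorry`); nothing booked; BSD is not proved by any of this. PARTITION: X5@2 multiplicative
GV-transport rows (K4ᵐ B1·O1; input LEO of `P49Kernel.prop49_of_LEO`, p671196) × all p —
reduces-the-named-input-of; bears_on K4 19922 / 19923 (`--supports stmt-BirchSwinnertonDyer-19923`).

## What (Greenberg LNM 1716 p. 115: «`𝒜[θ_s] ≅ Hom(ℤ_p(κ^s), E[p^∞]) ≅ E[p^∞] ⊗ (κ^{-s}) = A_{-s}`», in the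
## tree's co-induced model `BigRepModule ℤ_p p A` of `AnticyclotomicBigGaloisRep.lean`)

For the twist element `θ_u = C(u)T + C(u−1) = u(1+T) − 1 ∈ Λ = ℤ_p⟦T⟧` (`u ∈ ℤ`, `p ∣ u − 1`) acting on smooth
`p`-primary functions `Φ : ℤ_p → A` (`(T·Φ)(x) = Φ(x+1) − Φ(x)`):
* `twist_smul_apply` — `(θ_u·Φ)(x) = u·Φ(x+1) − Φ(x)`;
* `apply_eq_pow_smul_apply_add_natCast` — on `𝒜[θ_u]`: `Φ(x) = u^m·Φ(x + m)`; hence (smoothness + the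
  approximations `x + appr(−x) ∈ p^nℤ_p`) `Φ` is determined by `Φ(0)`:
  **`eq_zero_of_apply_zero_eq_zero`** (evaluation at `0` is injective on `𝒜[θ_u]`) and
  `apply_neg_eq_pow_smul_apply_zero` (`Φ(−c) = u^{appr_n c}·Φ(0)`);
* **`exists_torsionBy_twist_apply_zero_eq`** — evaluation at `0` is onto the `p^k`-torsion: for `a ∈ A`
  with `p^k a = 0` the function `x ↦ u'^{(x mod p^k)}·a` (`u u' ≡ 1 mod p^k`) lies in `𝒜[θ_u][p^k]` and takes
  the value `a` at `0`;
* **`bigRep_apply_zero_eq_pow_smul`** — for the representation `(g·Φ)(x) = ρ(g)Φ(x − κ g)` (`bigRep κ ρ`):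
  `(g·Φ)(0) = u^{(κ g mod p^k)} · ρ(g)(Φ 0)` on `𝒜[θ_u]` when `p^k Φ(0) = 0` — i.e. evaluation at `0`
  intertwines `𝒜[θ_u][p^k]` with the TWIST `A[p^k](χ_u)`, `χ_u(g) = u^{κ(g)}` (Greenberg's `A_{−s}` for
  `u = κ(γ)^{−s}`; the tree's `ZpExtension.galoisTwist`, whose exponent is the same `(κ g mod p^k).val`).
Elementary `p`-adic bookkeeping used: `PadicInt.appr_spec`, `dvd_appr_sub_appr`, `ker_toZModPow`,
`ZpExtension.pow_mod_zsmul_eq`-type congruences (`pow_smul_eq_pow_smul_of_modEq`).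

References: [GreenbergLNM1716] §4 pp. 105, 115–116 (the modules `A_s`, `𝒜`, `𝒜[θ_s]`); [SkinnerUrban2014]
§3.1.3 / Prop. 3.2.3 (co-induced model); [Washington1997] §13.1–13.2.
-/

set_option autoImplicit false
set_option linter.dupNamespace false

noncomputable section

open scoped Classical

namespace Summit.BirchSwinnertonDyer.BirchSwinnertonDyer.Theorems.P49Kernel

open Literature.NumberTheory.EllipticCurves Literature.NumberTheory.EllipticCurves.BigRepModule
  Literature.NumberTheory.GaloisRepresentations

variable {p : ℕ} [Fact p.Prime] {A : Type*} [AddCommGroup A] [Module ℤ_[p] A]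

/-! ## §1. `p`-adic bookkeeping: exponents modulo `p^k` -/

section Padic

omit [Fact p.Prime] [Module ℤ_[p] A] in
/-- If `p ∣ u − 1` and `p^k · a = 0` then `u^m · a` depends on `m` only modulo `p^k` (integer scalars).
[cite: Washington1997, §13.1–§13.2] -/
theorem pow_zsmul_eq_pow_zsmul_of_modEq {u : ℤ} (hu : (p : ℤ) ∣ u - 1) {k : ℕ} {a : A} (ha : p ^ k • a = 0)
    {m m' : ℕ} (h : m ≡ m' [MOD p ^ k]) : (u ^ m) • a = (u ^ m') • a := by
  rw [← ZpExtension.pow_mod_zsmul_eq_of_nsmul_eq_zero ha hu m,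
    ← ZpExtension.pow_mod_zsmul_eq_of_nsmul_eq_zero ha hu m', h]

/-- The same with `ℤ_p`-scalars `(u : ℤ_p)^m`. [cite: Washington1997, §13.1–§13.2] -/
theorem pow_smul_eq_pow_smul_of_modEq {u : ℤ} (hu : (p : ℤ) ∣ u - 1) {k : ℕ} {a : A} (ha : p ^ k • a = 0)
    {m m' : ℕ} (h : m ≡ m' [MOD p ^ k]) : ((u : ℤ_[p]) ^ m) • a = ((u : ℤ_[p]) ^ m') • a := by
  rw [← Int.cast_pow, ← Int.cast_pow, Int.cast_smul_eq_zsmul, Int.cast_smul_eq_zsmul]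
  exact pow_zsmul_eq_pow_zsmul_of_modEq hu ha h

/-- `x + appr(−x) n ∈ p^n ℤ_p`. [folklore] -/
theorem add_appr_neg_mem_span (x : ℤ_[p]) (n : ℕ) :
    x + ((-x).appr n : ℤ_[p]) ∈ Ideal.span {(p : ℤ_[p]) ^ n} := by
  have h := PadicInt.appr_spec n (-x)
  have : x + ((-x).appr n : ℤ_[p]) = -((-x) - ((-x).appr n : ℤ_[p])) := by ring
  rw [this]
  exact Submodule.neg_mem _ h

/-- `(toZModPow k c).val = appr c k`. [folklore] -/
theorem val_toZModPow_eq_appr (k : ℕ) (c : ℤ_[p]) : (PadicInt.toZModPow k c).val = c.appr k := by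
  change ((c.appr k : ℕ) : ZMod (p ^ k)).val = c.appr k
  rw [ZMod.val_natCast, Nat.mod_eq_of_lt (PadicInt.appr_lt c k)]

/-- `appr c n ≡ (toZModPow k c).val (mod p^k)` for `k ≤ n`. [folklore] -/
theorem appr_modEq_val_toZModPow {k n : ℕ} (hkn : k ≤ n) (c : ℤ_[p]) :
    c.appr n ≡ (PadicInt.toZModPow k c).val [MOD p ^ k] := by
  rw [val_toZModPow_eq_appr]
  exact (Nat.modEq_iff_dvd' (PadicInt.appr_mono c hkn)).mpr (PadicInt.dvd_appr_sub_appr c k n hkn) |>.symm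

/-- `(toZModPow k (x + 1)).val ≡ (toZModPow k x).val + 1 (mod p^k)`. [folklore] -/
theorem val_toZModPow_add_one_modEq (k : ℕ) (x : ℤ_[p]) :
    (PadicInt.toZModPow k (x + 1)).val ≡ (PadicInt.toZModPow k x).val + 1 [MOD p ^ k] := by
  haveI : NeZero (p ^ k) := ⟨pow_ne_zero _ (Fact.out : p.Prime).ne_zero⟩
  rw [map_add, map_one, ZMod.val_add, Nat.ModEq]
  rcases Nat.eq_zero_or_pos k with rfl | hk
  · simp [Nat.mod_one]
  · haveI : Fact (1 < p ^ k) := ⟨Nat.one_lt_pow hk.ne' (Fact.out : p.Prime).one_lt⟩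
    rw [ZMod.val_one, Nat.mod_mod]

end Padic

/-! ## §2. The `θ_u`-kernel of `C^∞(ℤ_p, A)` -/

section Kernel

variable {u : ℤ}

/-- **`(θ_u·Φ)(x) = u·Φ(x+1) − Φ(x)`** for `θ_u = C(u)T + C(u−1)` (`T` acts as `τ₁ − 1`, constants as
scalars). [cite: GreenbergLNM1716, §4 p. 115 (θ_s acting on 𝒜)] -/
theorem twist_smul_apply (Φ : BigRepModule ℤ_[p] p A) (x : ℤ_[p]) :
    ((PowerSeries.C ((u : ℤ_[p])) * PowerSeries.X + PowerSeries.C ((u : ℤ_[p]) - 1) : IwasawaAlgebra p) • Φ) x =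
      (u : ℤ_[p]) • Φ (x + 1) - Φ x := by
  rw [add_smul, mul_smul, X_smul, C_smul, C_smul, BigRepModule.add_apply, BigRepModule.smul_apply,
    shiftSubOne_apply, BigRepModule.smul_apply, smul_sub, sub_smul, one_smul]
  abel

/-- On `𝒜[θ_u]`: `u·Φ(x+1) = Φ(x)`. [cite: GreenbergLNM1716, §4 p. 115] -/
theorem smul_apply_add_one_of_twist_smul_eq_zero {Φ : BigRepModule ℤ_[p] p A}
    (hΦ : (PowerSeries.C ((u : ℤ_[p])) * PowerSeries.X + PowerSeries.C ((u : ℤ_[p]) - 1) : IwasawaAlgebra p) • Φ = 0)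
    (x : ℤ_[p]) : (u : ℤ_[p]) • Φ (x + 1) = Φ x := by
  have h := congrArg (fun Ψ : BigRepModule ℤ_[p] p A ↦ Ψ x) hΦ
  simp only [twist_smul_apply, BigRepModule.zero_apply] at h
  exact sub_eq_zero.mp h

/-- **On `𝒜[θ_u]`: `Φ(x) = u^m·Φ(x + m)`** for every natural `m`. [cite: GreenbergLNM1716, §4 p. 115] -/
theorem apply_eq_pow_smul_apply_add_natCast {Φ : BigRepModule ℤ_[p] p A}
    (hΦ : (PowerSeries.C ((u : ℤ_[p])) * PowerSeries.X + PowerSeries.C ((u : ℤ_[p]) - 1) : IwasawaAlgebra p) • Φ = 0)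
    (x : ℤ_[p]) (m : ℕ) : Φ x = ((u : ℤ_[p]) ^ m) • Φ (x + m) := by
  induction m generalizing x with
  | zero => rw [pow_zero, one_smul, Nat.cast_zero, add_zero]
  | succ m ih =>
    rw [ih x, pow_succ, mul_smul, Nat.cast_succ, ← add_assoc, smul_apply_add_one_of_twist_smul_eq_zero hΦ (x + m)]

/-- **On `𝒜[θ_u]`, `Φ(−c) = u^{appr_n c}·Φ(0)`** for any `n` at least the level of `Φ`
(`−c + appr_n c ∈ p^n ℤ_p` and `Φ` is constant on cosets of `p^n ℤ_p`). [cite: GreenbergLNM1716, §4 p. 115] -/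
theorem apply_neg_eq_pow_smul_apply_zero {Φ : BigRepModule ℤ_[p] p A}
    (hΦ : (PowerSeries.C ((u : ℤ_[p])) * PowerSeries.X + PowerSeries.C ((u : ℤ_[p]) - 1) : IwasawaAlgebra p) • Φ = 0)
    {n : ℕ} (hn : IsSmoothOfLevel p A n Φ) (c : ℤ_[p]) :
    Φ (-c) = ((u : ℤ_[p]) ^ c.appr n) • Φ 0 := by
  rw [apply_eq_pow_smul_apply_add_natCast hΦ (-c) (c.appr n)]
  congr 1
  refine hn _ _ ?_
  rw [sub_zero]
  have h := add_appr_neg_mem_span (-c) n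
  rwa [neg_neg] at h

/-- **Evaluation at `0` is injective on `𝒜[θ_u]`.** [cite: GreenbergLNM1716, §4 p. 115 (𝒜[θ_s] ≅ A_{-s})] -/
theorem eq_zero_of_apply_zero_eq_zero {Φ : BigRepModule ℤ_[p] p A}
    (hΦ : (PowerSeries.C ((u : ℤ_[p])) * PowerSeries.X + PowerSeries.C ((u : ℤ_[p]) - 1) : IwasawaAlgebra p) • Φ = 0)
    (h0 : Φ 0 = 0) : Φ = 0 := by
  obtain ⟨n, hn⟩ := Φ.exists_level
  ext x
  have h := apply_neg_eq_pow_smul_apply_zero hΦ hn (-x)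
  rw [neg_neg, h0, smul_zero] at h
  rw [h, BigRepModule.zero_apply]

/-- Two elements of `𝒜[θ_u]` with the same value at `0` are equal. [cite: GreenbergLNM1716, §4 p. 115] -/
theorem eq_of_apply_zero_eq {Φ Ψ : BigRepModule ℤ_[p] p A}
    (hΦ : (PowerSeries.C ((u : ℤ_[p])) * PowerSeries.X + PowerSeries.C ((u : ℤ_[p]) - 1) : IwasawaAlgebra p) • Φ = 0)
    (hΨ : (PowerSeries.C ((u : ℤ_[p])) * PowerSeries.X + PowerSeries.C ((u : ℤ_[p]) - 1) : IwasawaAlgebra p) • Ψ = 0)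
    (h0 : Φ 0 = Ψ 0) : Φ = Ψ := by
  rw [← sub_eq_zero]
  exact eq_zero_of_apply_zero_eq_zero (by rw [smul_sub, hΦ, hΨ, sub_zero]) (by rw [BigRepModule.sub_apply, h0, sub_self])

/-- **Evaluation at `0` maps `𝒜[θ_u][p^k]` ONTO `A[p^k]`**: for `a` with `p^k·a = 0` and `u'` with
`u u' ≡ 1 (mod p^k)`, the smooth function `x ↦ u'^{(x mod p^k)}·a` lies in `𝒜[θ_u]`, is killed by `p^k`, and
takes the value `a` at `0`. [cite: GreenbergLNM1716, §4 p. 115 (𝒜[θ_s] ≅ A_{-s})] -/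
theorem exists_torsionBy_twist_apply_zero_eq {u' : ℤ} (hu' : (p : ℤ) ∣ u' - 1) {k : ℕ}
    (huu' : ((p : ℤ) ^ k) ∣ u * u' - 1) (a : A) (ha : p ^ k • a = 0) :
    ∃ Φ : BigRepModule ℤ_[p] p A,
      (PowerSeries.C ((u : ℤ_[p])) * PowerSeries.X + PowerSeries.C ((u : ℤ_[p]) - 1) : IwasawaAlgebra p) • Φ = 0 ∧
        ((p : IwasawaAlgebra p) ^ k) • Φ = 0 ∧ Φ 0 = a := by
  -- the candidate function
  have hmem : (fun x : ℤ_[p] ↦ (u' ^ (PadicInt.toZModPow k x).val) • a) ∈ bigRepSubmodule ℤ_[p] p A := by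
    refine ⟨⟨k, fun x y hxy ↦ ?_⟩, ⟨k, fun x ↦ ?_⟩⟩
    · -- `toZModPow k` is constant on cosets of `p^k ℤ_p` (tree: `AcTwistDeformation.toZModPow_eq_of_sub_mem`)
      have hk : PadicInt.toZModPow k x = PadicInt.toZModPow k y := by
        rw [← sub_eq_zero, ← map_sub, ← RingHom.mem_ker, PadicInt.ker_toZModPow]
        exact hxy
      simp only [hk]
    · simp only [smul_comm (p ^ k) (u' ^ _) a, ha, smul_zero]
  refine ⟨BigRepModule.mk _ hmem, ?_, ?_, ?_⟩
  · -- `θ_u`-kernel: `u · u'^{e(x+1)} a = u'^{e(x)} a`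
    ext x
    rw [twist_smul_apply, mk_apply, mk_apply, BigRepModule.zero_apply, sub_eq_zero,
      pow_zsmul_eq_pow_zsmul_of_modEq hu' ha (val_toZModPow_add_one_modEq k x), pow_succ', mul_smul,
      Int.cast_smul_eq_zsmul, smul_smul]
    -- `(u u') • b = b` for the `p^k`-torsion element `b = u'^e a`
    obtain ⟨c, hc⟩ := huu'
    have hb : p ^ k • ((u' ^ (PadicInt.toZModPow k x).val) • a) = 0 := by rw [smul_comm, ha, smul_zero]
    rw [show u * u' = (p : ℤ) ^ k * c + 1 by rw [← hc]; ring, add_smul, one_smul, mul_comm, mul_smul,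
      ← Nat.cast_pow, natCast_zsmul, hb, smul_zero, zero_add]
  · -- `p^k`-torsion
    ext x
    rw [← map_natCast (PowerSeries.C (R := ℤ_[p])), ← map_pow, C_smul, BigRepModule.smul_apply, mk_apply,
      BigRepModule.zero_apply,
      ← Nat.cast_pow, Nat.cast_smul_eq_nsmul, smul_comm, ha, smul_zero]
  · rw [mk_apply, map_zero, ZMod.val_zero, pow_zero, one_smul]

end Kernel

/-! ## §3. The `G`-action on `𝒜[θ_u]` read at `0`: the twist `u^{κ(g)} ρ(g)` -/

section Action

variable {G : Type*} [Group G] [TopologicalSpace G] [IsTopologicalGroup G] [TopologicalSpace A]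
  [DiscreteTopology A]
  [TopologicalSpace (PowerSeries ℤ_[p])] (κ : G →ₜ* Multiplicative ℤ_[p]) (ρ : ContinuousRep G ℤ_[p] A)
  {u : ℤ}

/-- **`(g·Φ)(0) = u^{(κ g mod p^k)} · ρ(g)(Φ 0)` on `𝒜[θ_u]`** when `p^k·Φ(0) = 0`: the co-induced action
`(g·Φ)(x) = ρ(g)(Φ(x − κ g))` evaluated at `0` is `ρ(g)(Φ(−κ g)) = ρ(g)(u^{appr(κ g)}·Φ 0)`, and the
exponent matters only modulo `p^k`. This is Greenberg's `𝒜[θ_s] ≅ E[p^∞] ⊗ κ^{−s}` (p. 115) at finite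
level, with the exponent `(κ g mod p^k).val` of the tree's `ZpExtension.galoisTwist`.
[cite: GreenbergLNM1716, §4 p. 115] -/
theorem bigRep_apply_zero_eq_pow_smul (hu : (p : ℤ) ∣ u - 1) {Φ : BigRepModule ℤ_[p] p A}
    (hΦ : (PowerSeries.C ((u : ℤ_[p])) * PowerSeries.X + PowerSeries.C ((u : ℤ_[p]) - 1) : IwasawaAlgebra p) • Φ = 0)
    {k : ℕ} (hk : p ^ k • Φ 0 = 0) (g : G) :
    bigRep κ ρ g Φ 0 = ((u : ℤ_[p]) ^ (PadicInt.toZModPow k (κ g).toAdd).val) • ρ g (Φ 0) := by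
  obtain ⟨n, hn⟩ := Φ.exists_level
  -- raise the level above `k`
  have hn' : IsSmoothOfLevel p A (n + k) Φ := fun x y hxy ↦
    hn x y (Ideal.span_singleton_le_span_singleton.mpr (pow_dvd_pow _ (Nat.le_add_right n k)) hxy)
  rw [bigRep_apply_apply, zero_sub, apply_neg_eq_pow_smul_apply_zero hΦ hn' (κ g).toAdd, map_smul,
    pow_smul_eq_pow_smul_of_modEq hu (by rw [← map_nsmul, hk, map_zero])
      (appr_modEq_val_toZModPow (Nat.le_add_left k n) _)]

end Action

end Summit.BirchSwinnertonDyer.BirchSwinnertonDyer.Theorems.P49Kernel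

end
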